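import Literature.Barriers.NavierStokesRegularity.NavierStokesInequalityCantorOscillation
import HarnessLib

/-!
# Oscillatory processes for Scheffer's Cantor block, II: Ożański's Theorem 17

Second support file on the discharge path of fact D′
`Literature.Barriers.NavierStokesRegularity.NSICantorBlock_of_arrangement` (the level data of a
geometric arrangement for Theorem 14 = Ożański's Proposition 16 with (6.8)–(6.12),
`NavierStokesInequalityCantorArrangement`). We PROVE W. S. Ożański, arXiv:1709.00602v4,
**Theorem 17** (§6.4, "the new oscillatory processes", the `𝔐`-pair sharpening of Theorem 10 =
Thm. 4.3 used in §6.3 Step 2 to build the profiles `q^{𝔪,k}` of Proposition 16): for each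
`k ≥ 1` and `𝔪 = 1,…,𝔐` there are `a_1^{𝔪,k}, a_2^{𝔪,k} ∈ C^∞(ℝ;[-1,1])` such that
`∫₀ᵗ a_i^{𝔪,k}(s)(G_i^𝔪(x,s) + Σ_{l=1,2}Σ_{𝔫=1}^{𝔐} F_{i,l}^{𝔪,𝔫}(x,s,a_l^{𝔫,k}(s))) ds` converges as
`k → ∞` to `½∫₀ᵗ(F_{2,1}^{𝔪,𝔪}(x,s,1) - F_{2,1}^{𝔪,𝔪}(x,s,0)) ds` for `i = 2` and to `0` for `i = 1`,
uniformly in `(x,t) ∈ P × [0,T]` and `𝔪`, for all bounded uniformly continuous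
`G_i^𝔪 : P × [0,T] → ℝ`, `F_{i,l}^{𝔪,𝔫} : P × [0,T] × [-1,1] → ℝ` with `F(x,t,-1) = F(x,t,1)`
((6.27)). The processes are Ożański's (p. 32): smoothings of the square waves
`b_i^{𝔪,k}(t) = b_i(k4^{𝔪-1}t)` ((6.29)) — `b₁ = (1,-1,0,0)`, `b₂ = (1,1,-1,-1)` on the quarters
of `[0,T]` ((4.24)) — "by letting `b_i^{(𝔪)}` have `4` times higher frequency than
`b_i^{(𝔪-1)}`", so that (6.28) `∫₀ᵀ b_i^{(𝔪)} f(b_l^{(𝔫)}) = T/2(f(1)-f(0))` for `(i,l) = (2,1)`,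
`𝔫 = 𝔪`, and `0` otherwise (`f(-1) = f(1)`); "the convergence can be obtained by letting
`b^{𝔪,k}` be oscillations of the above form with frequency increasing with `k` … We omit the
detailed calculation. Finally … the smoothness of the processes can be obtained by smooth
approximation … `|{a_i^{𝔪,k} ≠ b_i^{𝔪,k}}| ≤ 1/k`."

## Rendering

* Indices `i, l ∈ {1,2}` are `Fin 2` (`0 ↦ 1`, `1 ↦ 2`), as in the accepted Theorem 10
  (`NavierStokesInequalityOscillatoryProcesses`); the pairs are indexed by `a : Fin 𝔐`, the
  FREQUENCY EXPONENT read downwards: pair `a` oscillates with quarter length `4ᵃh`,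
  `h = T/(k4^𝔐)` (Ożański's `𝔪 = 𝔐 - a`; Theorem 17 is symmetric under relabelling the pairs).
* `cantorOscProcess T 𝔐 k i a = process cⁱ (4ᵃh) ((k+1)4ᵃ) (k4^{𝔐-a})`: the accepted smoothed
  square wave (`Scheffer.process`) with quarter values `cⁱ = quarterValues i`, `k4^{𝔐-a}`
  quarters of length `4ᵃh` covering `[0,T]`, and sharpness `(k+1)4ᵃ`, so that ALL processes have
  transition layers of the common width `h/(k+1)` around the points of the finest grid: on the
  plateaus of the finest grid every process equals its square wave
  (`cantorOscProcess_eq_wave_of_mem_plateau`), and the smoothing changes each integral by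
  `O(T/(k+1))` (`abs_integral_le_of_eqOn_plateau_zero` of the accepted file).
* "bounded and uniformly continuous", "uniformly in `(x,t)`": as in Theorem 10 (a uniform bound,
  joint continuity in `(s,b)`, uniform moduli in `s`; `P` any set), `cantorOscProcess_spec` is the
  `ε`–`K` statement and `exists_cantorOscillatoryProcesses` the printed form.

## Proof

On a plateau of the finest grid the integrand is
`Σ_r e_r φ_r`, `r ∈ {G} ⊔ (l, a', b)`, with the patterns `e_G = wave cⁱ (4ᵃh)`,
`e_{l,a',b} = wave cⁱ (4ᵃh) · [wave cˡ (4ᵃ'h) = b]` (`b ∈ {1,-1,0}`, `F(x,s,w) = Σ_b [w=b]F(x,s,b)`)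
and the continuous factors `φ_G = G_i(x,·)`, `φ_{l,a',b} = F_{i,l}^{a,a'}(x,·,b)`; every pattern is
`T/k`-periodic with period mean `A_r` computed in part I (`0` for `e_G` and for `a' ≠ a`,
`¼Σ_q cⁱ_q[cˡ_q = b]` for `a' = a`), so the averaging estimate of part I gives
`∫₀ᵗ e_r φ_r ≈ A_r ∫₀ᵗ φ_r` up to `2εT + 2NT/k`, and `Σ_r A_r ∫₀ᵗ φ_r = Σ_l ¼Σ_q cⁱ_q ∫₀ᵗ F_{i,l}^{a,a}(x,s,cˡ_q) ds`
is the printed limit by (6.28) (`sum_quarterValues_mul_apply`).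

## References

* W. S. Ożański, arXiv:1709.00602v4 (2017/2019), §6.4, Theorem 17, (6.27)–(6.29); §4.3,
  Theorem 10 and pp. 18–19. [`Ozanski2017NSISingular`]
* V. Scheffer, Comm. Math. Phys. 110 (1987), Lemma 3.2. [`Scheffer1987`]
-/

noncomputable section

open Set MeasureTheory intervalIntegral Function
open scoped Interval ContDiff

namespace Literature.Barriers.NavierStokesRegularity

namespace Scheffer

/-! ### The processes -/

/-- **Ożański's new oscillatory processes** `a_i^{𝔪,k}` (Theorem 17; (6.29) smoothed as on
p. 32): for `𝔐` pairs, `k ≥ 1`, `i ∈ {0,1}` and frequency exponent `a : Fin 𝔐`, the smoothed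
square wave with quarter values `cⁱ`, quarter length `4ᵃh` (`h = T/(k4^𝔐)`), `k4^{𝔐-a}`
quarters covering `[0,T]` and sharpness `(k+1)4ᵃ` (transition width `h/(k+1)`).
[cite: Ozanski2017NSISingular, §6.4 Thm. 17 and (6.29)] -/
def cantorOscProcess (T : ℝ) (𝔐 k : ℕ) (i : Fin 2) (a : Fin 𝔐) : ℝ → ℝ :=
  process (quarterValues i) (4 ^ (a : ℕ) * (T / (k * 4 ^ 𝔐))) (((k : ℝ) + 1) * 4 ^ (a : ℕ))
    (k * 4 ^ (𝔐 - a))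

/-- **The processes are smooth.** [cite: Ozanski2017NSISingular, §6.4 Thm. 17] -/
theorem contDiff_cantorOscProcess (T : ℝ) (𝔐 k : ℕ) (i : Fin 2) (a : Fin 𝔐) :
    ContDiff ℝ ∞ (cantorOscProcess T 𝔐 k i a) :=
  contDiff_process _ _ _ _

/-- **The processes take values in `[-1,1]`.** [cite: Ozanski2017NSISingular, §6.4 Thm. 17] -/
theorem abs_cantorOscProcess_le_one {T : ℝ} (hT : 0 < T) (𝔐 k : ℕ) (i : Fin 2) (a : Fin 𝔐)
    (s : ℝ) : |cantorOscProcess T 𝔐 k i a s| ≤ 1 := by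
  rcases k.eq_zero_or_pos with hk | hk
  · subst hk
    simp [cantorOscProcess]
  · have hk' : (0 : ℝ) < k := by exact_mod_cast hk
    exact abs_process_le_one (abs_quarterValues_le i) (by positivity) (by positivity) _ _

/-- The processes take values in `[-1,1]` (interval form). [cite: Ozanski2017NSISingular, §6.4 Thm. 17] -/
theorem cantorOscProcess_mem_Icc {T : ℝ} (hT : 0 < T) (𝔐 k : ℕ) (i : Fin 2) (a : Fin 𝔐) (s : ℝ) :
    cantorOscProcess T 𝔐 k i a s ∈ Icc (-1 : ℝ) 1 :=
  abs_le.1 (abs_cantorOscProcess_le_one hT 𝔐 k i a s)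

/-! ### The plateaus of the finest grid -/

/-- **On the plateaus of the finest grid every process equals its square wave.** Let
`h = T/(k4^𝔐)`, `w = h/(2(k+1))`, `j < k4^𝔐` and `s ∈ [jh + w, (j+1)h - w]`; then for every
exponent `a ≤ 𝔐` the smoothed wave of quarter length `4ᵃh`, sharpness `(k+1)4ᵃ` and
`k4^{𝔐-a}` quarters, and the square wave `wave c (4ᵃh)`, both equal `c_{⌊j/4ᵃ⌋ mod 4}` at `s`
(the fine cell `j` lies in the quarter `⌊j/4ᵃ⌋` of the coarse grid, at distance `≥ w` from its
ends, and `w` is the common transition width). [cite: Ozanski2017NSISingular, §6.4 p. 32 and §4.3 p. 19] -/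
theorem process_eq_and_wave_eq_of_mem_plateau {T : ℝ} (hT : 0 < T) {k : ℕ} (hk : 0 < k)
    {𝔐 a : ℕ} (ha : a ≤ 𝔐) (c : Fin 4 → ℝ) {j : ℕ} (hj : j < k * 4 ^ 𝔐) {s : ℝ}
    (hs : s ∈ Icc ((j : ℝ) * (T / (k * 4 ^ 𝔐)) + T / (k * 4 ^ 𝔐) / (2 * (k + 1)))
      (((j : ℝ) + 1) * (T / (k * 4 ^ 𝔐)) - T / (k * 4 ^ 𝔐) / (2 * (k + 1)))) :
    process c (4 ^ a * (T / (k * 4 ^ 𝔐))) (((k : ℝ) + 1) * 4 ^ a) (k * 4 ^ (𝔐 - a)) s =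
        c ⟨(j / 4 ^ a) % 4, Nat.mod_lt _ (by norm_num)⟩ ∧
      wave c (4 ^ a * (T / (k * 4 ^ 𝔐))) s = c ⟨(j / 4 ^ a) % 4, Nat.mod_lt _ (by norm_num)⟩ := by
  have hk' : (0 : ℝ) < k := by exact_mod_cast hk
  set h : ℝ := T / (k * 4 ^ 𝔐) with hh_def
  have hh : 0 < h := by positivity
  set H : ℝ := 4 ^ a * h with hH_def
  have hH : 0 < H := by positivity
  set w : ℝ := h / (2 * (k + 1)) with hw_def
  have hw : 0 < w := by positivity
  have hd : 0 < 4 ^ a := by positivity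
  set J : ℕ := j / 4 ^ a with hJ_def
  -- the coarse quarter index is in range
  have hJ : J < k * 4 ^ (𝔐 - a) := by
    rw [hJ_def, Nat.div_lt_iff_lt_mul hd, mul_assoc, ← pow_add, Nat.sub_add_cancel ha]
    exact hj
  -- the fine cell lies in the coarse quarter
  have h1 : (J : ℝ) * H ≤ (j : ℝ) * h := by
    have : ((J * 4 ^ a : ℕ) : ℝ) ≤ j := by exact_mod_cast Nat.div_mul_le_self j (4 ^ a)
    push_cast at this
    calc (J : ℝ) * H = (J : ℝ) * 4 ^ a * h := by rw [hH_def]; ring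
      _ ≤ (j : ℝ) * h := mul_le_mul_of_nonneg_right this hh.le
  have h2 : ((j : ℝ) + 1) * h ≤ ((J : ℝ) + 1) * H := by
    have h3 : j + 1 ≤ (J + 1) * 4 ^ a := by
      have := Nat.lt_div_mul_add (a := j) hd
      rw [add_mul, one_mul]
      exact this
    have h4 : ((j + 1 : ℕ) : ℝ) ≤ (((J + 1) * 4 ^ a : ℕ) : ℝ) := by exact_mod_cast h3
    push_cast at h4
    calc ((j : ℝ) + 1) * h ≤ ((J : ℝ) + 1) * 4 ^ a * h := mul_le_mul_of_nonneg_right h4 hh.le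
      _ = ((J : ℝ) + 1) * H := by rw [hH_def]; ring
  have hwR : H / (2 * (((k : ℝ) + 1) * 4 ^ a)) = w := by
    rw [hH_def, hw_def]
    field_simp
  constructor
  · refine process_eq hH (by positivity) hJ ?_
    rw [hwR, abs_le]
    constructor <;> nlinarith [hs.1, hs.2, h1, h2]
  · refine wave_eqOn hH c J ⟨?_, ?_⟩
    · linarith [hs.1]
    · linarith [hs.2]

/-- The processes on the plateaus of the finest grid: `a_i^{a,k}(s) = wave cⁱ (4ᵃh) s`.
[cite: Ozanski2017NSISingular, §6.4 p. 32] -/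
theorem cantorOscProcess_eq_wave_of_mem_plateau {T : ℝ} (hT : 0 < T) {𝔐 k : ℕ} (hk : 0 < k)
    (i : Fin 2) (a : Fin 𝔐) {j : ℕ} (hj : j < k * 4 ^ 𝔐) {s : ℝ}
    (hs : s ∈ Icc ((j : ℝ) * (T / (k * 4 ^ 𝔐)) + T / (k * 4 ^ 𝔐) / (2 * (k + 1)))
      (((j : ℝ) + 1) * (T / (k * 4 ^ 𝔐)) - T / (k * 4 ^ 𝔐) / (2 * (k + 1)))) :
    cantorOscProcess T 𝔐 k i a s = wave (quarterValues i) (4 ^ (a : ℕ) * (T / (k * 4 ^ 𝔐))) s := by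
  obtain ⟨h1, h2⟩ := process_eq_and_wave_eq_of_mem_plateau hT hk (le_of_lt a.is_lt)
    (quarterValues i) hj hs
  rw [cantorOscProcess, h1, h2]

/-! ### The approximation lemma for general patterns -/

/-- The averaging estimate of part I in the normalisation `p = T/k`: for a pattern `e` with
`|e| ≤ 1`, cellwise constant on the finest grid (`4^𝔐k` cells of mesh `T/(k4^𝔐)`), with period
integrals `∫_{αT/k}^{(α+1)T/k} e = (T/k)A` (`|A| ≤ 1`), and `φ` continuous on `[0,T]` with
`|φ| ≤ N` and `|φ(s) - φ(s')| ≤ ε` for `|s - s'| ≤ T/k`: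
`|∫₀ᵗ e φ - A∫₀ᵗ φ| ≤ 2εT + 2N T/k`. [cite: Ozanski2017NSISingular, §4.3 (4.30)–(4.31) and §6.4 p. 32] -/
theorem abs_integral_mul_sub_le_of_period' {T : ℝ} (hT : 0 < T) {k : ℕ} (hk : 0 < k) (𝔐 : ℕ)
    {e : ℝ → ℝ} (he1 : ∀ s, |e s| ≤ 1) (hecell : IsCellConst (T / (k * 4 ^ 𝔐)) (4 ^ 𝔐 * k) e)
    {A : ℝ} (hA1 : |A| ≤ 1)
    (hA : ∀ α : ℕ, α < k → ∫ s in ((α : ℝ) * (T / k))..(((α : ℝ) + 1) * (T / k)), e s = T / k * A)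
    {φ : ℝ → ℝ} (hφ : ContinuousOn φ (Icc 0 T)) {N ε : ℝ} (hN : ∀ s ∈ Icc 0 T, |φ s| ≤ N)
    (hε : ∀ s ∈ Icc 0 T, ∀ s' ∈ Icc 0 T, |s - s'| ≤ T / k → |φ s - φ s'| ≤ ε)
    {t : ℝ} (ht : t ∈ Icc 0 T) :
    |(∫ s in 0..t, e s * φ s) - A * ∫ s in 0..t, φ s| ≤ 2 * ε * T + 2 * N * (T / k) := by
  have hk' : (0 : ℝ) < k := by exact_mod_cast hk
  have e1 : (k : ℝ) * (T / k) = T := by field_simp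
  have e2 : (((4 ^ 𝔐 * k : ℕ) : ℝ)) * (T / (k * 4 ^ 𝔐)) = T := by push_cast; field_simp
  have hI : ∀ {ψ : ℝ → ℝ}, ContinuousOn ψ (Icc 0 ((k : ℝ) * (T / k))) → ∀ {u v : ℝ},
      u ∈ Icc 0 ((k : ℝ) * (T / k)) → v ∈ Icc 0 ((k : ℝ) * (T / k)) →
      IntervalIntegrable (fun s => e s * ψ s) volume u v := fun {ψ} hψ {u v} hu hv => by
    rw [e1] at hψ hu hv
    exact hecell.intervalIntegrable_mul_of_mem (by positivity) (e2.symm ▸ hψ) (e2.symm ▸ hu)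
      (e2.symm ▸ hv)
  have := abs_integral_mul_sub_le_of_period (p := T / k) (by positivity) hk he1 hI hA1 hA
    (φ := φ) (e1.symm ▸ hφ) (N := N) (ε := ε) (e1.symm ▸ hN) (e1.symm ▸ hε) (t := t) (e1.symm ▸ ht)
  rwa [e1] at this

/-- **Approximation lemma for general patterns** (the structure of the proof of Theorem 17,
after that of Theorem 10, pp. 18–19). Let `k ≥ 1`, `h = T/(k4^𝔐)`, `w = h/(2(k+1))`, and let `A`
be integrable on `[0,T]` with `|A| ≤ B`. Suppose that on every plateau `[jh + w, (j+1)h - w]`,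
`j < k4^𝔐`, `A` agrees with a finite sum `Σ_r e_r φ_r` of patterns `e_r` (`|e_r| ≤ 1`, cellwise
constant on the finest grid, with period integrals `∫_{αT/k}^{(α+1)T/k} e_r = (T/k)A_r`,
`|A_r| ≤ 1`) times continuous `φ_r` (`|φ_r| ≤ N`, `|φ_r(s) - φ_r(s')| ≤ ε` for `|s - s'| ≤ T/k`).
Then for all `t ∈ [0,T]`, with `m` the number of terms,
`|∫₀ᵗ A - Σ_r A_r ∫₀ᵗ φ_r| ≤ (B + mN) T/(k+1) + m(2εT + 2N T/k)`.
[cite: Ozanski2017NSISingular, §6.4 p. 32 and §4.3 pp. 18–19] -/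
theorem abs_integral_sub_sum_le_of_patterns {T : ℝ} (hT : 0 < T) {k : ℕ} (hk : 0 < k) (𝔐 : ℕ)
    {ι : Type*} [Fintype ι] (e : ι → ℝ → ℝ) (he1 : ∀ r s, |e r s| ≤ 1)
    (hecell : ∀ r, IsCellConst (T / (k * 4 ^ 𝔐)) (4 ^ 𝔐 * k) (e r))
    (Acoef : ι → ℝ) (hA1 : ∀ r, |Acoef r| ≤ 1)
    (hA : ∀ r, ∀ α : ℕ, α < k →
      ∫ s in ((α : ℝ) * (T / k))..(((α : ℝ) + 1) * (T / k)), e r s = T / k * Acoef r)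
    (φ : ι → ℝ → ℝ) (hφ : ∀ r, ContinuousOn (φ r) (Icc 0 T)) {N ε B : ℝ}
    (hN : ∀ r, ∀ s ∈ Icc 0 T, |φ r s| ≤ N)
    (hε : ∀ r, ∀ s ∈ Icc 0 T, ∀ s' ∈ Icc 0 T, |s - s'| ≤ T / k → |φ r s - φ r s'| ≤ ε)
    {A : ℝ → ℝ} (hAI : IntervalIntegrable A volume 0 T) (hB : ∀ s ∈ Icc 0 T, |A s| ≤ B)
    (hAg : ∀ j < k * 4 ^ 𝔐, ∀ s ∈ Icc ((j : ℝ) * (T / (k * 4 ^ 𝔐)) + T / (k * 4 ^ 𝔐) / (2 * (k + 1)))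
        (((j : ℝ) + 1) * (T / (k * 4 ^ 𝔐)) - T / (k * 4 ^ 𝔐) / (2 * (k + 1))),
        A s = ∑ r, e r s * φ r s)
    {t : ℝ} (ht : t ∈ Icc 0 T) :
    |(∫ s in 0..t, A s) - ∑ r, Acoef r * ∫ s in 0..t, φ r s| ≤
      (B + Fintype.card ι * N) * (T / (k + 1)) +
        Fintype.card ι * (2 * ε * T + 2 * N * (T / k)) := by
  have hk' : (0 : ℝ) < k := by exact_mod_cast hk
  set h : ℝ := T / (k * 4 ^ 𝔐) with hh_def
  have hh : 0 < h := by positivity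
  have hnh : ((k * 4 ^ 𝔐 : ℕ) : ℝ) * h = T := by rw [hh_def]; push_cast; field_simp
  have hnh' : ((4 ^ 𝔐 * k : ℕ) : ℝ) * h = T := by rw [← hnh]; push_cast; ring
  set w : ℝ := h / (2 * (k + 1)) with hw_def
  have hw : 0 < w := by positivity
  have hw2 : 2 * w ≤ h := by
    rw [hw_def, mul_div_assoc', div_le_iff₀ (by positivity)]
    nlinarith
  have h0T : (0 : ℝ) ∈ Icc 0 T := ⟨le_rfl, hT.le⟩
  set m : ℕ := Fintype.card ι with hm_def
  -- the model function `g = Σ_r e_r φ_r`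
  set g : ℝ → ℝ := fun s => ∑ r, e r s * φ r s with hg_def
  have hIr : ∀ r, ∀ {u v : ℝ}, u ∈ Icc 0 T → v ∈ Icc 0 T →
      IntervalIntegrable (fun s => e r s * φ r s) volume u v := fun r u v hu hv =>
    (hecell r).intervalIntegrable_mul_of_mem hh (hnh'.symm ▸ hφ r) (hnh'.symm ▸ hu)
      (hnh'.symm ▸ hv)
  have hIg : ∀ {u v : ℝ}, u ∈ Icc 0 T → v ∈ Icc 0 T → IntervalIntegrable g volume u v :=
    fun hu hv => by
    have := IntervalIntegrable.sum (μ := volume) Finset.univ fun r _ => hIr r hu hv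
    refine this.congr fun s _ => ?_
    simp [hg_def, Finset.sum_apply]
  have hgN : ∀ s ∈ Icc 0 T, |g s| ≤ m * N := fun s hs => by
    calc |g s| ≤ ∑ r, |e r s * φ r s| := Finset.abs_sum_le_sum_abs _ _
      _ ≤ ∑ _r : ι, N := Finset.sum_le_sum fun r _ => by
          rw [abs_mul]
          calc |e r s| * |φ r s| ≤ 1 * N :=
                mul_le_mul (he1 r s) (hN r s hs) (abs_nonneg _) zero_le_one
            _ = N := one_mul N
      _ = m * N := by simp [hm_def]
  -- (1) the smoothing error `∫₀ᵗ (A - g)`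
  have herr : |∫ s in 0..t, (A s - g s)| ≤ (k * 4 ^ 𝔐 : ℕ) * (2 * w * (B + m * N)) := by
    refine abs_integral_le_of_eqOn_plateau_zero hh hw hw2 (n := k * 4 ^ 𝔐) (f := fun s => A s - g s)
      ?_ ?_ ?_ (hnh.symm ▸ ht)
    · rw [hnh]; exact hAI.sub (hIg h0T ⟨hT.le, le_rfl⟩)
    · intro s hs
      rw [hnh] at hs
      calc |A s - g s| ≤ |A s| + |g s| := abs_sub _ _
        _ ≤ B + m * N := add_le_add (hB s hs) (hgN s hs)
    · intro j hj s hs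
      rw [hAg j hj s (by rw [hw_def, hh_def] at hs; exact hs)]
      simp [hg_def]
  have herr' : ((k * 4 ^ 𝔐 : ℕ) : ℝ) * (2 * w * (B + m * N)) = (B + m * N) * (T / (k + 1)) := by
    rw [hw_def, ← hnh]
    push_cast
    field_simp
  -- (2) the averaging errors
  have havg : ∀ r, |(∫ s in 0..t, e r s * φ r s) - Acoef r * ∫ s in 0..t, φ r s|
      ≤ 2 * ε * T + 2 * N * (T / k) := fun r =>
    abs_integral_mul_sub_le_of_period' hT hk 𝔐 (he1 r) (hecell r) (hA1 r) (hA r) (hφ r) (hN r)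
      (hε r) ht
  -- combine
  have hsplit : (∫ s in 0..t, A s) = (∫ s in 0..t, (A s - g s)) + ∫ s in 0..t, g s := by
    rw [intervalIntegral.integral_sub (hAI.mono_set (by
        rw [uIcc_of_le hT.le, uIcc_of_le ht.1]; exact Icc_subset_Icc le_rfl ht.2))
      (hIg h0T ht)]
    ring
  have hgsum : ∫ s in 0..t, g s = ∑ r, ∫ s in 0..t, e r s * φ r s := by
    rw [hg_def, intervalIntegral.integral_finsetSum]
    exact fun r _ => hIr r h0T ht
  rw [hsplit, hgsum, add_sub_assoc, ← Finset.sum_sub_distrib]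
  calc |(∫ s in 0..t, (A s - g s)) +
          ∑ r, ((∫ s in 0..t, e r s * φ r s) - Acoef r * ∫ s in 0..t, φ r s)|
      ≤ |∫ s in 0..t, (A s - g s)| +
          |∑ r, ((∫ s in 0..t, e r s * φ r s) - Acoef r * ∫ s in 0..t, φ r s)| :=
        abs_add_le _ _
    _ ≤ (B + m * N) * (T / (k + 1)) + ∑ r, |(∫ s in 0..t, e r s * φ r s) -
          Acoef r * ∫ s in 0..t, φ r s| :=
        add_le_add (herr.trans_eq herr') (Finset.abs_sum_le_sum_abs _ _)
    _ ≤ (B + m * N) * (T / (k + 1)) + ∑ _r : ι, (2 * ε * T + 2 * N * (T / k)) := by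
        gcongr with r _
        exact havg r
    _ = (B + m * N) * (T / (k + 1)) + m * (2 * ε * T + 2 * N * (T / k)) := by
        rw [Finset.sum_const, Finset.card_univ, hm_def, nsmul_eq_mul]

/-! ### Theorem 17 -/

/-- The basic values lie in `[-1, 1]`. [folklore] -/
theorem basicValues_mem_Icc (b : Fin 3) : basicValues b ∈ Icc (-1 : ℝ) 1 := by
  fin_cases b <;> simp [basicValues]

/-- **Ożański's Theorem 17 (the new oscillatory processes), quantitative core.** Let `T > 0`,
`𝔐 ∈ ℕ`, `P` a set of parameters, `G_i^a : P × [0,T] → ℝ` and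
`F_{i,l}^{a,a'} : P × [0,T] × [-1,1] → ℝ` (`i, l ∈ {0,1}`, `a, a' : Fin 𝔐`) bounded by `N`, continuous
in `(s,b)`, uniformly equicontinuous in `s`, with `F_{i,l}^{a,a'}(x,s,-1) = F_{i,l}^{a,a'}(x,s,1)`. Then
for every `ε > 0` there is `K` such that for all `k ≥ K`, `i`, `a`, `x ∈ P`, `t ∈ [0,T]`, with
`a_lᵃ' = cantorOscProcess T 𝔐 k l a'`:
`|∫₀ᵗ a_iᵃ(s)(G_iᵃ(x,s) + Σ_{l,a'} F_{i,l}^{a,a'}(x,s,a_lᵃ'(s))) ds - L_i| ≤ ε`, where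
`L₁ = ½∫₀ᵗ(F_{1,0}^{a,a}(x,s,1) - F_{1,0}^{a,a}(x,s,0)) ds` and `L₀ = 0` — i.e. (6.27): convergence
to `½∫₀ᵗ(F_{2,1}^{𝔪,𝔪}(x,s,1) - F_{2,1}^{𝔪,𝔪}(x,s,0)) ds` for his `i = 2` and to `0` for his
`i = 1`, uniformly in `(x,t) ∈ P × [0,T]` and in the pair index.
[cite: Ozanski2017NSISingular, §6.4 Thm. 17 (6.27)] -/
theorem cantorOscProcess_spec {T : ℝ} (hT : 0 < T) (𝔐 : ℕ) {X : Type*} (P : Set X)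
    (G : Fin 2 → Fin 𝔐 → X → ℝ → ℝ) (F : Fin 2 → Fin 2 → Fin 𝔐 → Fin 𝔐 → X → ℝ → ℝ → ℝ)
    (N : ℝ) (hGN : ∀ i a, ∀ x ∈ P, ∀ s ∈ Icc 0 T, |G i a x s| ≤ N)
    (hFN : ∀ i l a a', ∀ x ∈ P, ∀ s ∈ Icc 0 T, ∀ b ∈ Icc (-1 : ℝ) 1, |F i l a a' x s b| ≤ N)
    (hFc : ∀ i l a a', ∀ x ∈ P, ContinuousOn (uncurry (F i l a a' x)) (Icc 0 T ×ˢ Icc (-1) 1))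
    (hGu : ∀ ε > 0, ∃ δ > 0, ∀ i a, ∀ x ∈ P, ∀ s ∈ Icc 0 T, ∀ s' ∈ Icc 0 T,
      |s - s'| < δ → |G i a x s - G i a x s'| ≤ ε)
    (hFu : ∀ ε > 0, ∃ δ > 0, ∀ i l a a', ∀ x ∈ P, ∀ b ∈ Icc (-1 : ℝ) 1, ∀ s ∈ Icc 0 T,
      ∀ s' ∈ Icc 0 T, |s - s'| < δ → |F i l a a' x s b - F i l a a' x s' b| ≤ ε)
    (hFsymm : ∀ i l a a', ∀ x ∈ P, ∀ s ∈ Icc 0 T, F i l a a' x s (-1) = F i l a a' x s 1) :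
    ∀ ε > 0, ∃ K : ℕ, ∀ k ≥ K, ∀ (i : Fin 2) (a : Fin 𝔐), ∀ x ∈ P, ∀ t ∈ Icc 0 T,
      |(∫ s in 0..t, cantorOscProcess T 𝔐 k i a s *
          (G i a x s + ∑ l, ∑ a', F i l a a' x s (cantorOscProcess T 𝔐 k l a' s))) -
        (if i = 1 then 1 / 2 * ∫ s in 0..t, (F 1 0 a a x s 1 - F 1 0 a a x s 0) else 0)| ≤ ε := by
  intro ε hε
  -- nothing to prove when there are no pairs
  cases 𝔐 with
  | zero => exact ⟨0, fun k _ i a => a.elim0⟩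
  | succ A =>
  -- a positive common bound
  set N' : ℝ := max N 1 with hN'_def
  have hN'1 : 1 ≤ N' := le_max_right _ _
  have hN'0 : 0 < N' := lt_of_lt_of_le one_pos hN'1
  have hGN' : ∀ i a, ∀ x ∈ P, ∀ s ∈ Icc 0 T, |G i a x s| ≤ N' := fun i a x hx s hs =>
    (hGN i a x hx s hs).trans (le_max_left _ _)
  have hFN' : ∀ i l a a', ∀ x ∈ P, ∀ s ∈ Icc 0 T, ∀ b ∈ Icc (-1 : ℝ) 1, |F i l a a' x s b| ≤ N' :=
    fun i l a a' x hx s hs b hb => (hFN i l a a' x hx s hs b hb).trans (le_max_left _ _)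
  -- the number of model terms and the bound on the integrand
  set ι := Option (Fin 2 × Fin (A + 1) × Fin 3)
  set m : ℕ := Fintype.card ι with hm_def
  have hm0 : (0 : ℝ) < m := by
    have : 0 < m := Fintype.card_pos_iff.2 ⟨none⟩
    exact_mod_cast this
  set B : ℝ := (1 + 2 * ((A : ℝ) + 1)) * N' with hB_def
  have hB0 : 0 ≤ B := by positivity
  -- moduli at the scale `ε' = ε/(4mT)`
  set ε' : ℝ := ε / (4 * m * T) with hε'_def
  have hε' : 0 < ε' := by positivity
  obtain ⟨δ₁, hδ₁, hGmod⟩ := hGu ε' hε'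
  obtain ⟨δ₂, hδ₂, hFmod⟩ := hFu ε' hε'
  -- choice of `K`
  set C₀ : ℝ := (B + m * N') * T + m * (2 * N' * T) with hC₀_def
  have hC₀ : 0 ≤ C₀ := by positivity
  obtain ⟨K, hK⟩ := exists_nat_gt (max (T / min δ₁ δ₂) (2 * C₀ / ε))
  refine ⟨K + 1, fun k hk i a x hx t ht => ?_⟩
  have hk0 : 0 < k := by omega
  have hk' : (0 : ℝ) < k := by exact_mod_cast hk0
  have hkK : (K : ℝ) < k := by exact_mod_cast hk
  have hKδ : T / min δ₁ δ₂ < k := (le_max_left _ _).trans_lt (hK.trans hkK)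
  have hKε : 2 * C₀ / ε < k := (le_max_right _ _).trans_lt (hK.trans hkK)
  have hTk : T / k < min δ₁ δ₂ := by
    rw [div_lt_iff₀ hk']
    rw [div_lt_iff₀ (lt_min hδ₁ hδ₂)] at hKδ
    linarith
  have hTk₁ : T / k < δ₁ := hTk.trans_le (min_le_left _ _)
  have hTk₂ : T / k < δ₂ := hTk.trans_le (min_le_right _ _)
  have hCk : C₀ / k < ε / 2 := by
    rw [div_lt_iff₀ hε] at hKε
    rw [div_lt_iff₀ hk']
    linarith
  -- the fine mesh and the common period
  set h : ℝ := T / (k * 4 ^ (A + 1)) with hh_def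
  have hh : 0 < h := by positivity
  have hP : 4 ^ (A + 1) * h = T / k := by rw [hh_def]; field_simp
  have ha : (a : ℕ) ≤ A := Nat.lt_succ_iff.1 a.is_lt
  -- the square waves of all processes
  set W : Fin 2 → Fin (A + 1) → ℝ → ℝ := fun l a' s =>
    wave (quarterValues l) (4 ^ (a' : ℕ) * h) s with hW_def
  have hW1 : ∀ l a' s, |W l a' s| ≤ 1 := fun l a' s => abs_wave_le (abs_quarterValues_le l) _ _
  have hWmem : ∀ l a' s, ∃ b : Fin 3, W l a' s = basicValues b := fun l a' s =>
    quarterValues_mem l _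
  have hWcell : ∀ l a', IsCellConst h (4 ^ (A + 1) * k) (W l a') := fun l a' => by
    have := isCellConst_wave_pow hh (quarterValues l) a' (4 ^ (A + 1 - a') * k)
    rwa [← mul_assoc, ← pow_add, Nat.add_sub_cancel' (le_of_lt a'.is_lt)] at this
  -- patterns, period means and continuous factors, indexed by `ι`
  set e : ι → ℝ → ℝ := fun r s => r.elim (W i a s)
    (fun p => W i a s * (if W p.1 p.2.1 s = basicValues p.2.2 then 1 else 0)) with he_def
  set Acoef : ι → ℝ := fun r => r.elim 0 (fun p => if p.2.1 = a then
    (∑ q, quarterValues i q * (if quarterValues p.1 q = basicValues p.2.2 then 1 else 0)) / 4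
    else 0) with hAcoef_def
  set φ : ι → ℝ → ℝ := fun r s => r.elim (G i a x s) (fun p => F i p.1 a p.2.1 x s (basicValues p.2.2))
    with hφ_def
  have he_none : ∀ s, e none s = W i a s := fun s => rfl
  have he_some : ∀ p s, e (some p) s = W i a s * (if W p.1 p.2.1 s = basicValues p.2.2 then 1 else 0) :=
    fun p s => rfl
  have hφ_none : ∀ s, φ none s = G i a x s := fun s => rfl
  have hφ_some : ∀ p s, φ (some p) s = F i p.1 a p.2.1 x s (basicValues p.2.2) := fun p s => rfl
  -- (F1) the patterns are bounded by `1`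
  have he1 : ∀ r s, |e r s| ≤ 1 := by
    rintro (_ | p) s
    · rw [he_none]; exact hW1 i a s
    · rw [he_some, abs_mul]
      have : |(if W p.1 p.2.1 s = basicValues p.2.2 then (1 : ℝ) else 0)| ≤ 1 := by
        split_ifs <;> simp
      calc |W i a s| * |(if W p.1 p.2.1 s = basicValues p.2.2 then (1 : ℝ) else 0)| ≤ 1 * 1 :=
            mul_le_mul (hW1 i a s) this (abs_nonneg _) zero_le_one
        _ = 1 := one_mul _
  -- (F2) the patterns are cellwise constant on the finest grid
  have hecell : ∀ r, IsCellConst (T / (k * 4 ^ (A + 1))) (4 ^ (A + 1) * k) (e r) := by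
    rintro (_ | p)
    · exact hWcell i a
    · exact (hWcell i a).mul ((hWcell p.1 p.2.1).comp fun v => if v = basicValues p.2.2 then 1 else 0)
  -- (F3) the period means are bounded by `1`
  have hA1 : ∀ r, |Acoef r| ≤ 1 := by
    rintro (_ | p)
    · simp [hAcoef_def]
    · simp only [hAcoef_def, Option.elim]
      split_ifs with hp
      · rw [abs_div, abs_of_pos (by norm_num : (0 : ℝ) < 4), div_le_one (by norm_num)]
        calc |∑ q, quarterValues i q * (if quarterValues p.1 q = basicValues p.2.2 then (1 : ℝ) else 0)|
            ≤ ∑ q, |quarterValues i q * (if quarterValues p.1 q = basicValues p.2.2 then (1 : ℝ) else 0)| :=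
              Finset.abs_sum_le_sum_abs _ _
          _ ≤ ∑ _q : Fin 4, (1 : ℝ) := Finset.sum_le_sum fun q _ => by
              rw [abs_mul]
              have : |(if quarterValues p.1 q = basicValues p.2.2 then (1 : ℝ) else 0)| ≤ 1 := by
                split_ifs <;> simp
              calc |quarterValues i q| * |(if quarterValues p.1 q = basicValues p.2.2 then (1 : ℝ) else 0)|
                  ≤ 1 * 1 := mul_le_mul (abs_quarterValues_le i q) this (abs_nonneg _) zero_le_one
                _ = 1 := one_mul _
          _ = 4 := by simp
      · simp
  -- (F4) the period integrals (part I: (6.28)–(6.29))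
  have hAper : ∀ r, ∀ α : ℕ, α < k →
      ∫ s in ((α : ℝ) * (T / k))..(((α : ℝ) + 1) * (T / k)), e r s = T / k * Acoef r := by
    rintro (_ | ⟨l, a', b⟩) α _
    · simp only [he_none, hAcoef_def, Option.elim, mul_zero]
      rw [← hP, hW_def]
      simp only
      rw [integral_wave_commonPeriod hh (quarterValues i) ha α, sum_quarterValues]
      ring
    · simp only [he_some, hAcoef_def, Option.elim]
      rw [← hP, hW_def]
      simp only
      by_cases hp : a' = a
      · subst hp
        rw [if_pos rfl, integral_wave_mul_wave_commonPeriod_self hh (quarterValues i)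
          (quarterValues l) (fun v => if v = basicValues b then (1 : ℝ) else 0) ha α]
      · have hne : (a : ℕ) ≠ (a' : ℕ) := fun heq => hp (Fin.ext heq).symm
        rw [if_neg hp, integral_wave_mul_wave_commonPeriod_of_ne hh (sum_quarterValues i)
          (quarterValues l) (fun v => if v = basicValues b then (1 : ℝ) else 0) ha
          (Nat.lt_succ_iff.1 a'.is_lt) hne α, mul_zero]
  -- (F5)–(F7) the continuous factors
  have hGc : ContinuousOn (G i a x) (Icc 0 T) :=
    continuousOn_of_modulus fun e' he' => by
      obtain ⟨δ, hδ, hmod⟩ := hGu e' he'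
      exact ⟨δ, hδ, fun s hs s' hs' hd => hmod i a x hx s hs s' hs' hd⟩
  have hFb : ∀ l a', ∀ b' ∈ Icc (-1 : ℝ) 1, ContinuousOn (fun s => F i l a a' x s b') (Icc 0 T) :=
    fun l a' b' hb' => continuousOn_comp_of_mem (hFc i l a a' x hx) continuous_const fun _ => hb'
  have hφc : ∀ r, ContinuousOn (φ r) (Icc 0 T) := by
    rintro (_ | p)
    · exact hGc
    · exact hFb p.1 p.2.1 _ (basicValues_mem_Icc p.2.2)
  have hφN : ∀ r, ∀ s ∈ Icc 0 T, |φ r s| ≤ N' := by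
    rintro (_ | p) s hs
    · exact hGN' i a x hx s hs
    · exact hFN' i p.1 a p.2.1 x hx s hs _ (basicValues_mem_Icc p.2.2)
  have hφε : ∀ r, ∀ s ∈ Icc 0 T, ∀ s' ∈ Icc 0 T, |s - s'| ≤ T / k → |φ r s - φ r s'| ≤ ε' := by
    rintro (_ | p) s hs s' hs' hd
    · exact hGmod i a x hx s hs s' hs' (hd.trans_lt hTk₁)
    · exact hFmod i p.1 a p.2.1 x hx _ (basicValues_mem_Icc p.2.2) s hs s' hs' (hd.trans_lt hTk₂)
  -- (F8) the integrand: continuity, bound, and agreement with the model on the plateaus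
  set proc : Fin 2 → Fin (A + 1) → ℝ → ℝ := fun l a' => cantorOscProcess T (A + 1) k l a' with hproc
  have hproc_mem : ∀ l a' s, proc l a' s ∈ Icc (-1 : ℝ) 1 := fun l a' s =>
    cantorOscProcess_mem_Icc hT (A + 1) k l a' s
  have hproc_cont : ∀ l a', Continuous (proc l a') := fun l a' =>
    (contDiff_cantorOscProcess T (A + 1) k l a').continuous
  set 𝒜 : ℝ → ℝ := fun s => proc i a s * (G i a x s + ∑ l, ∑ a', F i l a a' x s (proc l a' s))
    with h𝒜_def
  have hinner : ContinuousOn (fun s => G i a x s + ∑ l, ∑ a', F i l a a' x s (proc l a' s))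
      (Icc 0 T) := by
    refine hGc.add (continuousOn_finsetSum _ fun l _ => continuousOn_finsetSum _ fun a' _ => ?_)
    exact continuousOn_comp_of_mem (hFc i l a a' x hx) (hproc_cont l a') (hproc_mem l a')
  have h𝒜c : ContinuousOn 𝒜 (Icc 0 T) := (hproc_cont i a).continuousOn.mul hinner
  have h𝒜I : IntervalIntegrable 𝒜 volume 0 T := by
    have hc := h𝒜c
    rw [← uIcc_of_le hT.le] at hc
    exact hc.intervalIntegrable
  have h𝒜B : ∀ s ∈ Icc 0 T, |𝒜 s| ≤ B := fun s hs => by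
    rw [h𝒜_def]
    simp only
    rw [abs_mul]
    have h1 : |G i a x s + ∑ l, ∑ a', F i l a a' x s (proc l a' s)| ≤ B := by
      calc |G i a x s + ∑ l, ∑ a', F i l a a' x s (proc l a' s)|
          ≤ |G i a x s| + |∑ l, ∑ a', F i l a a' x s (proc l a' s)| := abs_add_le _ _
        _ ≤ N' + ∑ l, ∑ a', |F i l a a' x s (proc l a' s)| := by
            refine add_le_add (hGN' i a x hx s hs) ?_
            refine (Finset.abs_sum_le_sum_abs _ _).trans (Finset.sum_le_sum fun l _ => ?_)
            exact Finset.abs_sum_le_sum_abs _ _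
        _ ≤ N' + ∑ _l : Fin 2, ∑ _a' : Fin (A + 1), N' := by
            gcongr with l _ a' _
            exact hFN' i l a a' x hx s hs _ (hproc_mem l a' s)
        _ = B := by
            simp only [Finset.sum_const, Finset.card_univ, Fintype.card_fin, nsmul_eq_mul, hB_def]
            push_cast
            ring
    calc |proc i a s| * |G i a x s + ∑ l, ∑ a', F i l a a' x s (proc l a' s)| ≤ 1 * B :=
          mul_le_mul (abs_le.2 ⟨by linarith [(hproc_mem i a s).1], (hproc_mem i a s).2⟩) h1
            (abs_nonneg _) zero_le_one
      _ = B := one_mul _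
  have h𝒜g : ∀ j < k * 4 ^ (A + 1), ∀ s ∈ Icc ((j : ℝ) * (T / (k * 4 ^ (A + 1))) +
        T / (k * 4 ^ (A + 1)) / (2 * (k + 1)))
      (((j : ℝ) + 1) * (T / (k * 4 ^ (A + 1))) - T / (k * 4 ^ (A + 1)) / (2 * (k + 1))),
      𝒜 s = ∑ r, e r s * φ r s := by
    intro j hj s hs
    have hps : ∀ l a', proc l a' s = W l a' s := fun l a' =>
      cantorOscProcess_eq_wave_of_mem_plateau hT hk0 l a' hj hs
    rw [h𝒜_def]
    simp only
    rw [Fintype.sum_option, he_none, hφ_none, Fintype.sum_prod_type]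
    simp_rw [Fintype.sum_prod_type, he_some, hφ_some, hps]
    rw [mul_add, Finset.mul_sum]
    congr 1
    refine Finset.sum_congr rfl fun l _ => ?_
    rw [Finset.mul_sum]
    refine Finset.sum_congr rfl fun a' _ => ?_
    rw [apply_eq_sum_indicator_basicValues (F i l a a' x s) (hWmem l a' s), Finset.mul_sum]
    refine Finset.sum_congr rfl fun b _ => ?_
    ring
  -- (F9) the approximation lemma
  have key := abs_integral_sub_sum_le_of_patterns hT hk0 (A + 1) e he1 hecell Acoef hA1 hAper φ
    hφc hφN hφε h𝒜I h𝒜B h𝒜g ht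
  -- (F10) identification of the limit via (6.28)
  have hsymmI : ∀ l, (∫ s in 0..t, F i l a a x s (-1)) = ∫ s in 0..t, F i l a a x s 1 := fun l => by
    refine intervalIntegral.integral_congr fun s hs => ?_
    rw [uIcc_of_le ht.1] at hs
    exact hFsymm i l a a x hx s ⟨hs.1, hs.2.trans ht.2⟩
  have hlim : ∑ r, Acoef r * ∫ s in 0..t, φ r s =
      if i = 1 then 1 / 2 * ∫ s in 0..t, (F 1 0 a a x s 1 - F 1 0 a a x s 0) else 0 := by
    rw [Fintype.sum_option]
    simp only [hAcoef_def, hφ_def, Option.elim, zero_mul, zero_add]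
    rw [Fintype.sum_prod_type]
    simp_rw [Fintype.sum_prod_type]
    -- the sum over `a'` collapses to `a' = a`
    have hcollapse : ∀ l : Fin 2, ∑ a' : Fin (A + 1), ∑ b : Fin 3,
        (if a' = a then (∑ q, quarterValues i q *
          (if quarterValues l q = basicValues b then (1 : ℝ) else 0)) / 4 else 0) *
          ∫ s in 0..t, F i l a a' x s (basicValues b) =
        (∑ q, quarterValues i q * ∫ s in 0..t, F i l a a x s (quarterValues l q)) / 4 := by
      intro l
      rw [Finset.sum_eq_single a]
      · -- the term `a' = a`: swap the sums over `b` and `q`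
        have s1 : ∀ b : Fin 3, (if a = a then (∑ q, quarterValues i q *
              (if quarterValues l q = basicValues b then (1 : ℝ) else 0)) / 4 else 0) *
              ∫ s in 0..t, F i l a a x s (basicValues b) =
            ∑ q, quarterValues i q * (if quarterValues l q = basicValues b then (1 : ℝ) else 0) *
              (∫ s in 0..t, F i l a a x s (basicValues b)) / 4 := by
          intro b
          rw [if_pos rfl, Finset.sum_div, Finset.sum_mul]
          refine Finset.sum_congr rfl fun q _ => ?_
          ring
        rw [Finset.sum_congr rfl (fun b _ => s1 b), Finset.sum_comm, Finset.sum_div]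
        refine Finset.sum_congr rfl fun q _ => ?_
        rw [apply_eq_sum_indicator_basicValues (fun v => ∫ s in 0..t, F i l a a x s v)
          (quarterValues_mem l q), Finset.mul_sum, Finset.sum_div]
        refine Finset.sum_congr rfl fun b _ => ?_
        ring
      · intro a' _ hne
        exact Finset.sum_eq_zero fun b _ => by rw [if_neg hne, zero_mul]
      · intro hna
        exact absurd (Finset.mem_univ a) hna
    simp_rw [hcollapse]
    have hmain : ∀ l : Fin 2, (∑ q, quarterValues i q * ∫ s in 0..t, F i l a a x s (quarterValues l q)) / 4
        = if i = 1 ∧ l = 0 then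
            ((∫ s in 0..t, F i l a a x s 1) - ∫ s in 0..t, F i l a a x s 0) / 2 else 0 :=
      fun l => sum_quarterValues_mul_apply (f := fun v => ∫ s in 0..t, F i l a a x s v) (hsymmI l) i l
    rw [Fin.sum_univ_two, hmain 0, hmain 1]
    have hI1 : IntervalIntegrable (fun s => F 1 0 a a x s 1) volume 0 t := by
      have h1 := (continuousOn_comp_of_mem (hFc 1 0 a a x hx) continuous_const
        (fun _ => ⟨by norm_num, le_rfl⟩) : ContinuousOn (fun s => F 1 0 a a x s 1) (Icc 0 T)).mono
        (Icc_subset_Icc le_rfl ht.2)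
      rw [← uIcc_of_le ht.1] at h1
      exact h1.intervalIntegrable
    have hI0 : IntervalIntegrable (fun s => F 1 0 a a x s 0) volume 0 t := by
      have h1 := (continuousOn_comp_of_mem (hFc 1 0 a a x hx) continuous_const
        (fun _ => ⟨by norm_num, by norm_num⟩) : ContinuousOn (fun s => F 1 0 a a x s 0) (Icc 0 T)).mono
        (Icc_subset_Icc le_rfl ht.2)
      rw [← uIcc_of_le ht.1] at h1
      exact h1.intervalIntegrable
    by_cases hi : i = 1
    · subst hi
      have h10 : ¬ ((1 : Fin 2) = 1 ∧ (1 : Fin 2) = 0) := by decide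
      rw [if_pos ⟨rfl, rfl⟩, if_neg h10, if_pos rfl, add_zero, intervalIntegral.integral_sub hI1 hI0]
      ring
    · have h0 : ¬ (i = 1 ∧ (0 : Fin 2) = 0) := fun h' => hi h'.1
      have h1 : ¬ (i = 1 ∧ (1 : Fin 2) = 0) := fun h' => hi h'.1
      rw [if_neg h0, if_neg h1, if_neg hi, add_zero]
  -- (F11) conclusion
  rw [← hlim]
  refine key.trans ?_
  have hε'T : (m : ℝ) * (2 * ε' * T) = ε / 2 := by
    rw [hε'_def]; field_simp; ring
  have h1 : (B + m * N') * (T / (k + 1)) ≤ (B + m * N') * (T / k) := by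
    gcongr
    · linarith
  calc (B + m * N') * (T / (k + 1)) + m * (2 * ε' * T + 2 * N' * (T / k))
      = (B + m * N') * (T / (k + 1)) + m * (2 * N' * (T / k)) + m * (2 * ε' * T) := by ring
    _ ≤ (B + m * N') * (T / k) + m * (2 * N' * (T / k)) + ε / 2 := by rw [hε'T]; gcongr
    _ = C₀ / k + ε / 2 := by rw [hC₀_def]; field_simp
    _ ≤ ε / 2 + ε / 2 := by linarith [hCk]
    _ = ε := by ring

/-- **Ożański's Theorem 17 (the new oscillatory processes), as printed.** For `T > 0` and `𝔐`
pairs there are processes `a_i^{𝔪,k} ∈ C^∞(ℝ; [-1,1])` (`k ∈ ℕ`, `i ∈ {0,1}` = his `{1,2}`,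
`𝔪 : Fin 𝔐`) such that for all bounded and uniformly continuous `G_i^𝔪 : P × [0,T] → ℝ`,
`F_{i,l}^{𝔪,𝔫} : P × [0,T] × [-1,1] → ℝ` with `F_{i,l}^{𝔪,𝔫}(x,t,-1) = F_{i,l}^{𝔪,𝔫}(x,t,1)`,
`∫₀ᵗ a_i^{𝔪,k}(s)(G_i^𝔪(x,s) + Σ_{l}Σ_{𝔫} F_{i,l}^{𝔪,𝔫}(x,s,a_l^{𝔫,k}(s))) ds →
½∫₀ᵗ(F_{1,0}^{𝔪,𝔪}(x,s,1) - F_{1,0}^{𝔪,𝔪}(x,s,0)) ds` for `i = 1` and `→ 0` for `i = 0`, as `k → ∞`,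
uniformly in `(x,t) ∈ P × [0,T]` and `𝔪` ((6.27); the processes do not depend on `G`, `F`).
Here `P` is any subset of a pseudo-metric space (in print the half-plane). PROVED
(`cantorOscProcess_spec` with `a_i^{𝔪,k} = cantorOscProcess T 𝔐 k i 𝔪`); the case `𝔐 = 1` is
the accepted Theorem 10 (`exists_oscillatoryProcesses`).
[cite: Ozanski2017NSISingular, §6.4 Thm. 17] -/
theorem exists_cantorOscillatoryProcesses {T : ℝ} (hT : 0 < T) (𝔐 : ℕ) :
    ∃ a : ℕ → Fin 2 → Fin 𝔐 → ℝ → ℝ,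
      (∀ k i 𝔪, ContDiff ℝ ∞ (a k i 𝔪)) ∧ (∀ k i 𝔪 s, a k i 𝔪 s ∈ Icc (-1 : ℝ) 1) ∧
      ∀ {X : Type*} [PseudoMetricSpace X] (P : Set X) (G : Fin 2 → Fin 𝔐 → X → ℝ → ℝ)
        (F : Fin 2 → Fin 2 → Fin 𝔐 → Fin 𝔐 → X → ℝ → ℝ → ℝ),
        (∃ N, (∀ i 𝔪, ∀ x ∈ P, ∀ s ∈ Icc 0 T, |G i 𝔪 x s| ≤ N) ∧
          ∀ i l 𝔪 𝔫, ∀ x ∈ P, ∀ s ∈ Icc 0 T, ∀ b ∈ Icc (-1 : ℝ) 1, |F i l 𝔪 𝔫 x s b| ≤ N) →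
        (∀ i 𝔪, UniformContinuousOn (fun p : X × ℝ => G i 𝔪 p.1 p.2) (P ×ˢ Icc 0 T)) →
        (∀ i l 𝔪 𝔫, UniformContinuousOn (fun p : X × ℝ × ℝ => F i l 𝔪 𝔫 p.1 p.2.1 p.2.2)
          (P ×ˢ Icc 0 T ×ˢ Icc (-1) 1)) →
        (∀ i l 𝔪 𝔫, ∀ x ∈ P, ∀ s ∈ Icc 0 T, F i l 𝔪 𝔫 x s (-1) = F i l 𝔪 𝔫 x s 1) →
        ∀ ε > 0, ∃ K : ℕ, ∀ k ≥ K, ∀ 𝔪 : Fin 𝔐, ∀ x ∈ P, ∀ t ∈ Icc 0 T,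
          |(∫ s in 0..t, a k 1 𝔪 s *
              (G 1 𝔪 x s + ∑ l, ∑ 𝔫, F 1 l 𝔪 𝔫 x s (a k l 𝔫 s))) -
              1 / 2 * ∫ s in 0..t, (F 1 0 𝔪 𝔪 x s 1 - F 1 0 𝔪 𝔪 x s 0)| ≤ ε ∧
          |∫ s in 0..t, a k 0 𝔪 s *
              (G 0 𝔪 x s + ∑ l, ∑ 𝔫, F 0 l 𝔪 𝔫 x s (a k l 𝔫 s))| ≤ ε := by
  refine ⟨fun k i 𝔪 => cantorOscProcess T 𝔐 k i 𝔪, fun k i 𝔪 => contDiff_cantorOscProcess T 𝔐 k i 𝔪,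
    fun k i 𝔪 s => cantorOscProcess_mem_Icc hT 𝔐 k i 𝔪 s, ?_⟩
  intro X _ P G F hb hGuc hFuc hsymm ε hε
  obtain ⟨N, hGN, hFN⟩ := hb
  have hspec := cantorOscProcess_spec hT 𝔐 P G F N hGN hFN ?_ ?_ ?_ hsymm ε hε
  · obtain ⟨K, hK⟩ := hspec
    refine ⟨K, fun k hk 𝔪 x hx t ht => ⟨?_, ?_⟩⟩
    · simpa using hK k hk 1 𝔪 x hx t ht
    · simpa using hK k hk 0 𝔪 x hx t ht
  · intro i l 𝔪 𝔫 x hx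
    have hcont := (hFuc i l 𝔪 𝔫).continuousOn
    have hmap : MapsTo (fun q : ℝ × ℝ => (x, q)) (Icc 0 T ×ˢ Icc (-1) 1)
        (P ×ˢ Icc 0 T ×ˢ Icc (-1) 1) := fun q hq => ⟨hx, hq⟩
    have hc : Continuous fun q : ℝ × ℝ => ((x, q) : X × ℝ × ℝ) := by fun_prop
    exact (hcont.comp hc.continuousOn hmap).congr fun q _ => rfl
  · intro ε' hε'
    choose δ hδ hmod using fun i 𝔪 => Metric.uniformContinuousOn_iff_le.1 (hGuc i 𝔪) ε' hε'
    rcases Nat.eq_zero_or_pos 𝔐 with h0 | hpos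
    · exact ⟨1, one_pos, fun i 𝔪 => (Fin.cast h0 𝔪).elim0⟩
    · haveI : Nonempty (Fin 𝔐) := ⟨⟨0, hpos⟩⟩
      have hne : (Finset.univ : Finset (Fin 2 × Fin 𝔐)).Nonempty := Finset.univ_nonempty
      have hδ₀pos : 0 < Finset.univ.inf' hne (fun p : Fin 2 × Fin 𝔐 => δ p.1 p.2) := by
        rw [Finset.lt_inf'_iff]
        intro p _
        exact hδ p.1 p.2
      have hδ₀le : ∀ i 𝔪, Finset.univ.inf' hne (fun p : Fin 2 × Fin 𝔐 => δ p.1 p.2) ≤ δ i 𝔪 :=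
        fun i 𝔪 => Finset.inf'_le (fun p : Fin 2 × Fin 𝔐 => δ p.1 p.2) (Finset.mem_univ (i, 𝔪))
      refine ⟨_, hδ₀pos, fun i 𝔪 x hx s hs s' hs' hd => ?_⟩
      have hdi : |s - s'| ≤ δ i 𝔪 := hd.le.trans (hδ₀le i 𝔪)
      have hd' : dist ((x, s) : X × ℝ) (x, s') ≤ δ i 𝔪 := by
        rw [Prod.dist_eq, dist_self, Real.dist_eq]
        exact max_le (le_trans (abs_nonneg _) hdi) hdi
      have := hmod i 𝔪 (x, s) ⟨hx, hs⟩ (x, s') ⟨hx, hs'⟩ hd'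
      rwa [Real.dist_eq] at this
  · intro ε' hε'
    choose δ hδ hmod using fun i l 𝔪 𝔫 => Metric.uniformContinuousOn_iff_le.1 (hFuc i l 𝔪 𝔫) ε' hε'
    rcases Nat.eq_zero_or_pos 𝔐 with h0 | hpos
    · exact ⟨1, one_pos, fun i l 𝔪 => (Fin.cast h0 𝔪).elim0⟩
    · haveI : Nonempty (Fin 𝔐) := ⟨⟨0, hpos⟩⟩
      have hne : (Finset.univ : Finset (Fin 2 × Fin 2 × Fin 𝔐 × Fin 𝔐)).Nonempty :=
        Finset.univ_nonempty
      have hδ₀pos : 0 < Finset.univ.inf' hne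
          (fun p : Fin 2 × Fin 2 × Fin 𝔐 × Fin 𝔐 => δ p.1 p.2.1 p.2.2.1 p.2.2.2) := by
        rw [Finset.lt_inf'_iff]
        intro p _
        exact hδ _ _ _ _
      have hδ₀le : ∀ i l 𝔪 𝔫, Finset.univ.inf' hne
          (fun p : Fin 2 × Fin 2 × Fin 𝔐 × Fin 𝔐 => δ p.1 p.2.1 p.2.2.1 p.2.2.2) ≤ δ i l 𝔪 𝔫 :=
        fun i l 𝔪 𝔫 => Finset.inf'_le
          (fun p : Fin 2 × Fin 2 × Fin 𝔐 × Fin 𝔐 => δ p.1 p.2.1 p.2.2.1 p.2.2.2)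
          (Finset.mem_univ (i, l, 𝔪, 𝔫))
      refine ⟨_, hδ₀pos, fun i l 𝔪 𝔫 x hx b hb s hs s' hs' hd => ?_⟩
      have hdi : |s - s'| ≤ δ i l 𝔪 𝔫 := hd.le.trans (hδ₀le i l 𝔪 𝔫)
      have hd' : dist ((x, s, b) : X × ℝ × ℝ) (x, s', b) ≤ δ i l 𝔪 𝔫 := by
        rw [Prod.dist_eq, dist_self, Prod.dist_eq, dist_self, Real.dist_eq]
        refine max_le (le_trans (abs_nonneg _) hdi) (max_le hdi (le_trans (abs_nonneg _) hdi))
      have := hmod i l 𝔪 𝔫 (x, s, b) ⟨hx, hs, hb⟩ (x, s', b) ⟨hx, hs', hb⟩ hd'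
      rwa [Real.dist_eq] at this

end Scheffer

end Literature.Barriers.NavierStokesRegularity
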